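import Literature.NumberTheory.Transcendental.PkappaThetaMultiplication
import HarnessLib

/-!
# Addition laws and multiplication forms for one Weierstrass block `P = (σ³, σ³℘, σ³℘′)`

Topic: `Literature/NumberTheory/Transcendental`. A brick of the programme towards the named fact
`Literature.NumberTheory.Transcendental.philippon1986_std` with two or more elliptic factors
(forms cutting out the algebraic subgroups `∑_b c_b z'_b ≡ 0` of `E^γ` inside the theta model of
`M_κ`). The theta model `GaGmE.Std.theta` of `PkappaTheta.lean` SPECIALISED to
`(β, γ, δ) = (∅, pt, ∅)` is exactly the Weierstrass embedding `z ↦ P(z) = (P₀, P₁, P₂)(z)` of ONE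
elliptic block (`theta_blk`), so the complete systems of addition laws (`PkappaThetaLaws.lean`,
`GaGmE.Std.claw`) and of multiplication forms (`PkappaThetaMultiplication.lean`,
`GaGmE.Std.mulForm`) of the tree transport to the block, indexed by `Fin 3`:

* `WBlock.baddForm s i ∈ ℂ[X₀,X₁,X₂,Y₀,Y₁,Y₂]`, bidegree `(4, 4)`, with
  `baddForm(P(z), P(z')) = baddUnit s z z' · P_i(z + z')` for ALL `z, z'` (`eval_baddForm`) and units
  without common zero over the finite family `GaGmE.Std.clawFamily` (`exists_baddUnit_ne_zero`);
* `WBlock.bmulForm l i ∈ ℂ[X₀,X₁,X₂]`, homogeneous of degree `mulDeg |l|`, with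
  `bmulForm(P(z)) = bmulUnit l z · P_i((|l|+1) z)` for ALL `z` (`eval_bmulForm`), complete
  (`exists_bmulUnit_ne_zero`).

Everything is PROVED; no named facts.

## References

* Yu. V. Nesterenko, P. Philippon (eds.), *Introduction to Algebraic Independence Theory*,
  LNM 1752, Springer 2001, Ch. 11 (D. Roy), §2.1. [NesterenkoPhilippon2001]
-/

noncomputable section

open Complex MvPolynomial Set

namespace Literature.NumberTheory.Transcendental

namespace WBlock

open GaGmE GaGmE.Std

variable (L : PeriodPair)

/-! ### One block as a theta model -/

/-- No fibre weights (`δ = ∅`). [folklore] -/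
def κ0 : Empty → Unit → Kbar := fun e => e.elim

/-- The point of `V = ℂ^∅ × ℂ^{pt} × ℂ^∅` with elliptic coordinate `z` (the constant function).
[folklore] -/
def blk (z : ℂ) : Empty ⊕ (Unit ⊕ Empty) → ℂ := fun _ => z

/-- `blk` is additive. [folklore] -/
@[simp] theorem blk_add (z z' : ℂ) : blk z + blk z' = blk (z + z') := rfl

/-- `blk` commutes with multiples. [folklore] -/
@[simp] theorem nsmul_blk (n : ℕ) (z : ℂ) : n • blk z = blk (n • z) := by
  funext x; simp [blk]

/-- The theta indices of one block are `Fin 3`. [folklore] -/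
def idx3 : Fin 3 ≃ Option Empty × ThetaIdx Unit Empty where
  toFun i := (none, (fun _ => i, none))
  invFun J := J.2.1 ()
  left_inv i := rfl
  right_inv J := by
    obtain ⟨a, M, o⟩ := J
    rcases a with _ | a
    · rcases o with _ | e
      · rfl
      · exact e.elim
    · exact a.elim

/-- **The theta functions of one block are the Weierstrass coordinates**:
`Θ_J(blk z) = P_{idx3⁻¹ J}(z)`. [folklore] -/
theorem theta_blk (J : Option Empty × ThetaIdx Unit Empty) (z : ℂ) :
    theta L κ0 J (blk z) = L.univExtP (idx3.symm J) z := by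
  obtain ⟨a, M, o⟩ := J
  rcases a with _ | a
  · rcases o with _ | e
    · simp [theta, thetaPnone, blk, idx3]
    · exact e.elim
  · exact a.elim

/-- The Weierstrass point vector `P(z) = (P₀, P₁, P₂)(z)`. [folklore] -/
def wP (z : ℂ) : Fin 3 → ℂ := fun i => L.univExtP i z

/-- Evaluation at `P(z)` of a transported polynomial is `thetaEval` at `blk z`. [folklore] -/
theorem eval_rename_idx3 (Φ : MvPolynomial (Option Empty × ThetaIdx Unit Empty) ℂ) (z : ℂ) :
    eval (wP L z) (rename idx3.symm Φ) = thetaEval L κ0 Φ (blk z) := by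
  rw [eval_rename, thetaEval]
  have h : (wP L z ∘ idx3.symm) = fun J => theta L κ0 J (blk z) :=
    _root_.funext fun J => by simp [theta_blk, wP]
  rw [h]

/-! ### Multiplication forms on the block -/

/-- **The multiplication forms of one block**, transported from `GaGmE.Std.mulForm`. [folklore] -/
def bmulForm (l : List (Empty ⊕ (Unit ⊕ Empty) → ℂ)) (i : Fin 3) : MvPolynomial (Fin 3) ℂ :=
  rename idx3.symm (mulForm L κ0 l (idx3 i))

/-- Their units. [folklore] -/
def bmulUnit (l : List (Empty ⊕ (Unit ⊕ Empty) → ℂ)) (z : ℂ) : ℂ := mulUnit (β := Empty) (δ := Empty) L l (blk z)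

/-- The multiplication forms are forms of degree `mulDeg |l|`. [folklore] -/
theorem bmulForm_isHomogeneous (l : List (Empty ⊕ (Unit ⊕ Empty) → ℂ)) (i : Fin 3) :
    (bmulForm L l i).IsHomogeneous (mulDeg l.length) :=
  (mulForm_isHomogeneous L κ0 l (idx3 i)).rename_isHomogeneous

/-- **`bmulForm(P(z)) = bmulUnit l z · P_i((|l|+1) z)`** for ALL `z`. [folklore] -/
theorem eval_bmulForm (l : List (Empty ⊕ (Unit ⊕ Empty) → ℂ)) (i : Fin 3) (z : ℂ) :
    eval (wP L z) (bmulForm L l i) = bmulUnit L l z * L.univExtP i ((l.length + 1) • z) := by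
  rw [bmulForm, eval_rename_idx3, thetaEval_mulForm, nsmul_blk, theta_blk, Equiv.symm_apply_apply]
  rfl

/-- **Completeness of the multiplication forms on the block.** [folklore] -/
theorem exists_bmulUnit_ne_zero (n : ℕ) (z : ℂ) :
    ∃ c : Fin n → Fin (nClaw Unit),
      bmulUnit L (List.ofFn fun k => clawFamily (β := Empty) (δ := Empty) L (c k)) z ≠ 0 :=
  exists_mulUnit_ne_zero (β := Empty) (δ := Empty) L n (blk z)

/-- The units are analytic in `z`. [folklore] -/
theorem analyticOnNhd_bmulUnit (l : List (Empty ⊕ (Unit ⊕ Empty) → ℂ)) :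
    AnalyticOnNhd ℂ (bmulUnit L l) univ := by
  intro z _
  have hblk : AnalyticAt ℂ blk z := by
    have : (blk : ℂ → Empty ⊕ (Unit ⊕ Empty) → ℂ) = fun z => z • fun _ => (1 : ℂ) := by
      funext z x; simp [blk]
    rw [this]
    exact analyticAt_id.smul analyticAt_const
  exact (analyticOnNhd_mulUnit (β := Empty) (δ := Empty) L l _ (mem_univ _)).comp hblk

/-! ### Addition laws on the block -/

/-- **The addition laws of one block**, transported from `GaGmE.Std.claw`. [folklore] -/
def baddForm (s : Empty ⊕ (Unit ⊕ Empty) → ℂ) (i : Fin 3) : MvPolynomial (Fin 3 ⊕ Fin 3) ℂ :=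
  rename (Sum.map idx3.symm idx3.symm) (claw L κ0 s (idx3 i))

/-- Their units. [folklore] -/
def baddUnit (s : Empty ⊕ (Unit ⊕ Empty) → ℂ) (z z' : ℂ) : ℂ :=
  clawUnit (β := Empty) (δ := Empty) L s (blk z) (blk z')

/-- The addition laws have degree `4` in `X`. [folklore] -/
theorem baddForm_isWeightedHomogeneous_wX (s : Empty ⊕ (Unit ⊕ Empty) → ℂ) (i : Fin 3) :
    IsWeightedHomogeneous (wX (Fin 3)) (baddForm L s i) 4 := by
  refine isWeightedHomogeneous_rename _ _ ?_
  have h := claw_isWeightedHomogeneous L κ0 s (idx3 i)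
  convert h using 2
  funext J
  rcases J with J | J <;> rfl

/-- The addition laws have degree `4` in `Y`. [folklore] -/
theorem baddForm_isWeightedHomogeneous_wY (s : Empty ⊕ (Unit ⊕ Empty) → ℂ) (i : Fin 3) :
    IsWeightedHomogeneous (wY (Fin 3)) (baddForm L s i) 4 := by
  refine isWeightedHomogeneous_rename _ _ ?_
  have h := claw_isWeightedHomogeneous_wY L κ0 s (idx3 i)
  convert h using 2
  funext J
  rcases J with J | J <;> rfl

/-- **`baddForm(P(z), P(z')) = baddUnit s z z' · P_i(z + z')`** for ALL `z, z'`. [folklore] -/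
theorem eval_baddForm (s : Empty ⊕ (Unit ⊕ Empty) → ℂ) (i : Fin 3) (z z' : ℂ) :
    eval (Sum.elim (wP L z) (wP L z')) (baddForm L s i) = baddUnit L s z z' * L.univExtP i (z + z') := by
  rw [baddForm, eval_rename]
  have hfun : (Sum.elim (wP L z) (wP L z') ∘ Sum.map idx3.symm idx3.symm) =
      Sum.elim (fun J => theta L κ0 J (blk z)) fun J => theta L κ0 J (blk z') := by
    funext J
    rcases J with J | J <;> simp [theta_blk, wP]
  rw [hfun, eval_claw, blk_add, theta_blk, Equiv.symm_apply_apply]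
  rfl

/-- **Completeness of the addition laws on the block.** [folklore] -/
theorem exists_baddUnit_ne_zero (z z' : ℂ) :
    ∃ k : Fin (nClaw Unit), baddUnit L (clawFamily (β := Empty) (δ := Empty) L k) z z' ≠ 0 :=
  exists_clawUnit_clawFamily_ne_zero (β := Empty) (δ := Empty) L (blk z) (blk z')

end WBlock

end Literature.NumberTheory.Transcendental

end
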